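import Summits.BirchSwinnertonDyer.BirchSwinnertonDyer.Theorems.ClassRecordThreeEulerHalvesAtThreeCartanSupplyCubicLattice
import HarnessLib

/-!
# The cubic lattice, II: `(L/3L)^G = 0`, the two torus lines, and **SUPPLY at every prime `q ≡ 1 (mod 3)`**

Helper file `--supports stmt-BirchSwinnertonDyer-23422` (seat `bsd-stepL-tam3-p1` g23, LINE OWNER of crux 23422, line `cartan` v11), serving the registered
stub (SUPPLY) `stub_cartanTorusLatticeSupply : CartanCorrespondence.CartanTorusLatticeSupply` (memo `HOME/tam3-p1/g23/SUPPLY-ROAD-GG1.md` §2),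
continuing `…CubicLattice`. (1) `GL₂(𝔽_q)` is TRANSITIVE on the cubic classes (`σX_transitive`, via `SL₂`-matrices with prescribed first
column), so a vector of `L` fixed modulo `3` by `G` is `≡ c·𝟙 (mod 3)`; applying `S₀ = aT + bRT` (`T𝟙 = q𝟙`, `R𝟙 = 𝟙`) to `c𝟙 + 3ψ ∈ L` gives
`3 ∣ q·c·(a + b − 1)`, and the normalisation `a + b ≡ 2 (mod 3)` forces `3 ∣ c`; purity of `L` (a kernel) then gives **`(L/3L)^G = 0`**
(`noFixedVectorModThree`) — with NO hypothesis `3 ∤ #X` (here `#X = 3(q+1)`). (2) RANK BY TRACE with the tree's torus sums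
`Σ_{T_s} χ_W = |T_s|`, `Σ_{C(η)} χ_W = |C(η)|` (bsd-idea-10 g12 `…TorusLines`) gives the two TORUS LINES with generators (`splitLine`, `nonsplitLine`).
(3) ASSEMBLY: `toLattice h1 : CartanTorusLattice q` and **`cartanTorusLatticeSupplyAt`** — for every prime `q ≡ 1 (mod 3)` the full conclusion of
`CartanTorusLatticeSupply` at `q` (lattice of character `χ_W` BY NAME, invariant positive form, mod-3 condition, elliptic `η`, both torus lines with
generators), UNCONDITIONALLY. The cuspidal primes `q ≡ 2 (mod 3)` remain (different model); `q = 2` is `…CartanSignLatticeTwo` (p690778).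
HONEST FRAMING: the principal-series half of SUPPLY; NUM, crux 23422 ∕ 19109 are NOT touched; BSD is proved for no curve. [folklore]
-/

namespace Summit.BirchSwinnertonDyer.BirchSwinnertonDyer.Theorems.CartanSupply.CubicLattice

open Summit.BirchSwinnertonDyer.BirchSwinnertonDyer.Theorems.CartanDegree
open Summit.BirchSwinnertonDyer.BirchSwinnertonDyer.Theorems.CartanTorusCubeCut
open Summit.BirchSwinnertonDyer.BirchSwinnertonDyer.Theorems.CartanSupply.CubicClasses
open Summit.BirchSwinnertonDyer.BirchSwinnertonDyer.Theorems.CartanSupply.CubicHecke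
open Summit.BirchSwinnertonDyer.BirchSwinnertonDyer.Theorems.CartanSupply.CubicFibres
open Summit.BirchSwinnertonDyer.BirchSwinnertonDyer.Theorems.CartanSupply.CubicV1
open Summit.BirchSwinnertonDyer.BirchSwinnertonDyer.Theorems.CartanSupply.CubicDescent

set_option linter.dupNamespace false
set_option autoImplicit false

open scoped Classical

variable {q : ℕ} [Fact q.Prime]

/-! ## §1 Transitivity of `GL₂(𝔽_q)` on the cubic classes -/

/-- PROVED: a non-zero vector is the first column of a matrix of determinant `1`. [folklore] -/
theorem exists_det_one_col (v : V0 q) : ∃ P : G q, (P : Mat q).det = 1 ∧ (P : Mat q).mulVec (Pi.single 0 1) = v := by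
  have hne : (Finset.univ.filter fun w : Fin 2 → ZMod q => dt (v : Fin 2 → ZMod q) w = 1).Nonempty := by
    rw [← Finset.card_pos, card_dt_eq v 1]; exact (Fact.out : q.Prime).pos
  obtain ⟨w, hw⟩ := hne
  simp only [Finset.mem_filter, Finset.mem_univ, true_and] at hw
  let P : Mat q := Matrix.of fun i j : Fin 2 => if j = 0 then (v : Fin 2 → ZMod q) i else w i
  have hdet : P.det = 1 := by rw [CubicPointsFixed.det_of_cols]; exact hw
  refine ⟨Matrix.GeneralLinearGroup.mkOfDetNeZero P (by rw [hdet]; exact one_ne_zero), hdet, ?_⟩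
  show P.mulVec (Pi.single 0 1) = v
  rw [CubicPointsFixed.mulVec_single_zero]
  funext i
  simp [P]

/-- PROVED: `SL₂(𝔽_q)` is transitive on non-zero vectors. [folklore] -/
theorem exists_det_one_mulVec_eq (v w : V0 q) : ∃ g : G q, (g : Mat q).det = 1 ∧ (g : Mat q).mulVec v = w := by
  obtain ⟨Pv, hPv, hv⟩ := exists_det_one_col v
  obtain ⟨Pw, hPw, hw⟩ := exists_det_one_col w
  refine ⟨Pw * Pv⁻¹, ?_, ?_⟩
  · have h := congrArg (fun M : Mat q => M.det) (show ((Pw * Pv⁻¹ : G q) : Mat q) * (Pv : Mat q) = Pw by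
      rw [← Units.val_mul, inv_mul_cancel_right])
    simp only [Matrix.det_mul, hPv, mul_one, hPw] at h
    exact h
  · have hv' : ((Pv⁻¹ : G q) : Mat q).mulVec (v : Fin 2 → ZMod q) = Pi.single 0 1 := by
      rw [← hv, Matrix.mulVec_mulVec, ← Units.val_mul, inv_mul_cancel, Units.val_one, Matrix.one_mulVec]
    rw [Units.val_mul, ← Matrix.mulVec_mulVec, hv', hw]

/-- PROVED — **`GL₂(𝔽_q)` IS TRANSITIVE ON `X`**. [folklore] -/
theorem σX_transitive (x y : X q) : ∃ g : G q, σX g x = y := by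
  obtain ⟨v, rfl⟩ := mk_surjective x
  obtain ⟨w, rfl⟩ := mk_surjective y
  obtain ⟨g, hdet, hgv⟩ := exists_det_one_mulVec_eq v w
  refine ⟨g, ?_⟩
  rw [σX_mk]
  congr 1
  apply Subtype.ext
  rw [coe_actV, hdet, one_smul, hgv]

/-! ## §2 No fixed vector modulo `3` -/

/-- PROVED: `T` on constants: `T(c𝟙) = qc·𝟙`. [folklore] -/
theorem hecke_const (c : ℤ) : hecke ℤ (fun _ : X q => c) = fun _ => (q : ℤ) * c := by
  funext x
  rw [hecke_apply, ← Finset.sum_filter, Finset.sum_const, card_rel_eq, nsmul_eq_mul]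

/-- PROVED: `S₀` on constants: `S₀(c𝟙) = (a + b)qc·𝟙`. [folklore] -/
theorem S0_const (h1 : q % 3 = 1) (c : ℤ) : S0 h1 (fun _ : X q => c) = fun _ => ((eis h1).1 + (eis h1).2) * ((q : ℤ) * c) := by
  rw [S0_apply, hecke_const]
  funext x
  simp only [Pi.add_apply, Pi.smul_apply, smul_eq_mul, R, sc_apply]
  ring

/-- PROVED: a function on `X` invariant modulo `3` under `G` is constant modulo `3`. [folklore] -/
theorem const_mod_three {φ : X q → ℤ} (hφ : ∀ (g : G q) (x : X q), (3 : ℤ) ∣ φ x - φ (σX g x)) (x y : X q) : (3 : ℤ) ∣ φ x - φ y := by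
  obtain ⟨g, rfl⟩ := σX_transitive x y
  exact hφ g x

/-- PROVED: purity of `L` — `3ψ ∈ L ⇒ ψ ∈ L`. [folklore] -/
theorem mem_latL_of_three_smul (h1 : q % 3 = 1) {ψ : X q → ℤ} (h : (3 : ℤ) • ψ ∈ latL h1) : ψ ∈ latL h1 := by
  rw [mem_latL_iff] at h ⊢
  obtain ⟨hV, hS⟩ := h
  constructor
  · rw [V1, LinearMap.mem_ker] at hV ⊢
    rw [map_smul] at hV
    exact (smul_eq_zero.mp hV).resolve_left (by norm_num)
  · rw [map_smul, smul_comm] at hS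
    have h3 : (3 : ℤ) • (S0 h1 ψ - (q : ℤ) • ψ) = 0 := by rw [smul_sub, hS, sub_self]
    exact sub_eq_zero.mp ((smul_eq_zero.mp h3).resolve_left (by norm_num))

/-- PROVED — **`(L/3L)^G = 0`**: a vector of `ℤ^d` fixed modulo `3` by every `ρ(g)` lies in `3ℤ^d`. [folklore] -/
theorem noFixedVectorModThree (h1 : q % 3 = 1) (v : Fin (dL h1) → ℤ)
    (hv : ∀ g : G q, ∃ w : Fin (dL h1) → ℤ, rho h1 g v - v = (3 : ℤ) • w) : ∃ w : Fin (dL h1) → ℤ, v = (3 : ℤ) • w := by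
  set φ : X q → ℤ := embI h1 v with hφdef
  have hφL : φ ∈ latL h1 := embI_mem h1 v
  -- (a) `φ` is constant mod 3
  have hinv : ∀ (g : G q) (x : X q), (3 : ℤ) ∣ φ x - φ (σX g x) := by
    intro g x
    obtain ⟨w, hw⟩ := hv g
    have h := congrArg (fun u => embI h1 u (σX g x)) hw
    simp only [map_sub, map_smul, Pi.sub_apply, Pi.smul_apply, smul_eq_mul, embI_rho, act_apply_perm] at h
    exact ⟨embI h1 w (σX g x), h⟩
  obtain ⟨v₀⟩ : Nonempty (V0 q) := ⟨⟨![1, 0], by intro h; have := congrFun h 0; simp at this⟩⟩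
  set c : ℤ := φ (mk v₀) with hc
  have hdvd : ∀ x, (3 : ℤ) ∣ φ x - c := fun x => const_mod_three hinv x (mk v₀)
  -- (b) `φ = c𝟙 + 3ψ`
  set ψ : X q → ℤ := fun x => (φ x - c) / 3 with hψ
  have hφeq : φ = (fun _ => c) + (3 : ℤ) • ψ := by
    funext x
    simp only [Pi.add_apply, Pi.smul_apply, smul_eq_mul, hψ]
    rw [Int.mul_ediv_cancel' (hdvd x)]; ring
  -- (c) apply `S₀`: `S₀φ = qφ`
  have hS := ((mem_latL_iff h1 φ).mp hφL).2
  rw [hφeq, map_add, map_smul, S0_const, smul_add] at hS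
  have hx := congrFun hS (mk v₀)
  simp only [Pi.add_apply, Pi.smul_apply, smul_eq_mul] at hx
  -- `(a+b) q c + 3 S₀ψ(x) = q c + 3 q ψ(x)` ⇒ `3 ∣ q c (a + b − 1)`
  have h3 : (3 : ℤ) ∣ (q : ℤ) * (c * (((eis h1).1 + (eis h1).2) - 1)) :=
    ⟨(q : ℤ) * ψ (mk v₀) - S0 h1 ψ (mk v₀), by linear_combination hx⟩
  have hq3 : ¬ (3 : ℤ) ∣ (q : ℤ) := by
    intro h
    have : (3 : ℤ) ∣ ((q : ℕ) : ℤ) := h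
    omega
  have hab : ¬ (3 : ℤ) ∣ (((eis h1).1 + (eis h1).2) - 1) := by
    have := eis_mod h1
    omega
  have hc3 : (3 : ℤ) ∣ c := by
    rcases (Int.prime_three.dvd_or_dvd h3) with h | h
    · exact absurd h hq3
    · rcases (Int.prime_three.dvd_or_dvd h) with h' | h'
      · exact h'
      · exact absurd h' hab
  -- (d) `φ = 3ψ'` with `ψ' ∈ L`
  have hall : ∀ x, (3 : ℤ) ∣ φ x := fun x => by
    have := hdvd x
    have e : φ x = (φ x - c) + c := by ring
    rw [e]; exact dvd_add this hc3
  set ψ' : X q → ℤ := fun x => φ x / 3 with hψ'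
  have hφ3 : φ = (3 : ℤ) • ψ' := by
    funext x
    simp only [Pi.smul_apply, smul_eq_mul, hψ']
    rw [Int.mul_ediv_cancel' (hall x)]
  have hψ'L : ψ' ∈ latL h1 := mem_latL_of_three_smul h1 (hφ3 ▸ hφL)
  obtain ⟨w, hw⟩ := exists_embI_eq h1 hψ'L
  refine ⟨w, embI_injective h1 ?_⟩
  rw [map_smul, hw, ← hφ3]

/-! ## §3 The two torus lines -/

/-- PROVED: membership in the split torus subgroup. [folklore] -/
theorem mem_splitTorusSub_iff (g : G q) : g ∈ splitTorusSub q ↔ (g : Mat q) 0 1 = 0 ∧ (g : Mat q) 1 0 = 0 := Iff.rfl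

/-- PROVED: membership in the centraliser subgroup. [folklore] -/
theorem mem_centralizerSub_iff (η : Mat q) (g : G q) : g ∈ centralizerSub η ↔ (g : Mat q) * η = η * g := Iff.rfl

/-- PROVED — **THE SPLIT-TORUS LINE** of `ρ`. [folklore] -/
theorem splitLine (h1 : q % 3 = 1) :
    ∃ w : Fin (dL h1) → ℤ, (∀ g : G q, (g : Mat q) 0 1 = 0 → (g : Mat q) 1 0 = 0 → rho h1 g w = w) ∧ w ≠ 0 ∧
      ∀ v : Fin (dL h1) → ℤ, (∀ g : G q, (g : Mat q) 0 1 = 0 → (g : Mat q) 1 0 = 0 → rho h1 g v = v) → ∃ m : ℤ, v = m • w := by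
  have hsum : ∑ t : splitTorusSub q, LinearMap.trace ℤ (Fin (dL h1) → ℤ) (rho h1 (t : G q)) = Nat.card (splitTorusSub q) := by
    simp_rw [trace_rho]
    exact sum_char_splitTorusSub
  obtain ⟨w, hw, hw0, hgen⟩ := exists_generator_of_trace_rep (rho h1 : G q →* Module.End ℤ (Fin (dL h1) → ℤ)) (splitTorusSub q) hsum
  refine ⟨w, fun g h01 h10 => hw g ((mem_splitTorusSub_iff g).mpr ⟨h01, h10⟩), hw0, fun v hv => hgen v fun t ht => ?_⟩
  exact hv t ((mem_splitTorusSub_iff t).mp ht).1 ((mem_splitTorusSub_iff t).mp ht).2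

/-- PROVED — **THE NON-SPLIT-TORUS LINE** of `ρ` (for an elliptic `η`). [folklore] -/
theorem nonsplitLine (h1 : q % 3 = 1) {η : Mat q} (hη : ¬ HasRatEigenvalue η) :
    ∃ w : Fin (dL h1) → ℤ, (∀ g : G q, (g : Mat q) * η = η * g → rho h1 g w = w) ∧ w ≠ 0 ∧
      ∀ v : Fin (dL h1) → ℤ, (∀ g : G q, (g : Mat q) * η = η * g → rho h1 g v = v) → ∃ m : ℤ, v = m • w := by
  have hq2 : q ≠ 2 := by rintro rfl; simp at h1
  have hq3 : q ≠ 3 := by rintro rfl; simp at h1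
  have hsum : ∑ t : centralizerSub η, LinearMap.trace ℤ (Fin (dL h1) → ℤ) (rho h1 (t : G q)) = Nat.card (centralizerSub η) := by
    simp_rw [trace_rho]
    exact sum_char_centralizerSub hq2 hq3 hη
  obtain ⟨w, hw, hw0, hgen⟩ := exists_generator_of_trace_rep (rho h1 : G q →* Module.End ℤ (Fin (dL h1) → ℤ)) (centralizerSub η) hsum
  exact ⟨w, fun g hg => hw g ((mem_centralizerSub_iff η g).mpr hg), hw0,
    fun v hv => hgen v fun t ht => hv t ((mem_centralizerSub_iff η t).mp ht)⟩

/-! ## §4 Assembly: the Cartan torus lattice at `q ≡ 1 (mod 3)` -/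

/-- PROVED: `q ≠ 2`. [folklore] -/
theorem two_ne (h1 : q % 3 = 1) : q ≠ 2 := by rintro rfl; simp at h1

/-- An elliptic matrix. -/
noncomputable def eta (h1 : q % 3 = 1) : Mat q := Classical.choose (exists_not_hasRatEigenvalue (two_ne h1))

/-- PROVED: `η` has no rational eigenvalue. [folklore] -/
theorem eta_irred (h1 : q % 3 = 1) : ¬ HasRatEigenvalue (eta h1) := Classical.choose_spec (exists_not_hasRatEigenvalue (two_ne h1))

/-- **THE CUBIC CARTAN TORUS LATTICE** at a prime `q ≡ 1 (mod 3)`: the descended lattice `L ⊂ ℤ[X]` transported to `ℤ^d`. -/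
noncomputable def toLattice (h1 : q % 3 = 1) : CartanTorusLattice q where
  d := dL h1
  ρ := rho h1
  trace_eq := trace_rho h1
  B := formB h1
  B_symm := formB_symm h1
  B_pos := formB_pos h1
  B_inv := formB_inv h1
  noFixedVectorModThree := noFixedVectorModThree h1
  η := eta h1
  η_irred := eta_irred h1

/-- PROVED — **SUPPLY AT EVERY PRIME `q ≡ 1 (mod 3)`**: the conclusion of `CartanCorrespondence.CartanTorusLatticeSupply` at `q`, unconditionally
(principal-series half of the registered stub `stub_cartanTorusLatticeSupply` of crux 23422's line `cartan`). [folklore] -/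
theorem cartanTorusLatticeSupplyAt (h1 : q % 3 = 1) :
    ∃ (𝓛 : CartanTorusLattice q) (wS wC : Fin 𝓛.d → ℤ),
      𝓛.IsSplitFixed wS ∧ 𝓛.IsNonsplitFixed wC ∧
      (∀ v, 𝓛.IsSplitFixed v → ∃ m : ℤ, v = m • wS) ∧ (∀ v, 𝓛.IsNonsplitFixed v → ∃ m : ℤ, v = m • wC) ∧ wS ≠ 0 ∧ wC ≠ 0 := by
  obtain ⟨wS, hS, hS0, hSgen⟩ := splitLine h1
  obtain ⟨wC, hC, hC0, hCgen⟩ := nonsplitLine h1 (eta_irred h1)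
  exact ⟨toLattice h1, wS, wC, hS, hC, hSgen, hCgen, hS0, hC0⟩

/-! ## §5 What is left of SUPPLY: the cuspidal primes `q ≡ 2 (mod 3)`, `q ≥ 5` -/

/-- **SUPPLY, CUSPIDAL HALF**: the conclusion of `CartanTorusLatticeSupply` at every prime `q ≡ 2 (mod 3)`, `q ≥ 5` (the cuspidal `W_q` of
dimension `q − 1`). Design notes: `HOME/tam3-p1/g23/SUPPLY-CUSP-DESIGN.md` (`V^{pairs} ≅ Ind_C^G θ ⊕ W_q`, multiplicity-free). [folklore] -/
def CartanTorusLatticeSupplyCusp : Prop :=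
  ∀ (q : ℕ), q.Prime → q % 3 = 2 → 5 ≤ q → ∃ (𝓛 : CartanTorusLattice q) (wS wC : Fin 𝓛.d → ℤ),
    𝓛.IsSplitFixed wS ∧ 𝓛.IsNonsplitFixed wC ∧
    (∀ v, 𝓛.IsSplitFixed v → ∃ m : ℤ, v = m • wS) ∧ (∀ v, 𝓛.IsNonsplitFixed v → ∃ m : ℤ, v = m • wC) ∧ wS ≠ 0 ∧ wC ≠ 0

omit [Fact q.Prime] in
/-- PROVED — **SUPPLY ⟸ ITS CUSPIDAL HALF** (`CartanCorrespondence.CartanTorusLatticeSupply` BY NAME): the principal-series primes are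
`cartanTorusLatticeSupplyAt`, `q = 2` is `CartanSignLatticeTwo.cartanTorusLatticeSupply_two` (p690778). [folklore] -/
theorem cartanTorusLatticeSupply_of_cusp (h : CartanTorusLatticeSupplyCusp) : CartanCorrespondence.CartanTorusLatticeSupply := by
  intro q hq h3
  haveI : Fact q.Prime := ⟨hq⟩
  rcases prime_mod_three hq h3 with h1 | h2
  · exact cartanTorusLatticeSupplyAt h1
  · by_cases hq2 : q = 2
    · subst hq2
      exact CartanSignLatticeTwo.cartanTorusLatticeSupply_two
    · have h5 : 5 ≤ q := by
        have h2' := hq.two_le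
        have : q ≠ 3 := h3
        have : q ≠ 4 := by rintro rfl; exact absurd hq (by decide)
        omega
      exact h q hq h2 h5

end Summit.BirchSwinnertonDyer.BirchSwinnertonDyer.Theorems.CartanSupply.CubicLattice
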